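import Summits.QuantumFields.YangMills.Theorems.PoincareLipschitzKnitFlatEndgameLetters
import Summits.QuantumFields.YangMills.Theorems.PoincareLipschitzKnitFlatEndgameRows
import Summits.QuantumFields.YangMills.Theorems.PoincareLipschitzKnitLadderLetters
import Summits.QuantumFields.YangMills.Theorems.PoincareLipschitzKnitDoorRows
import Summits.QuantumFields.YangMills.Theorems.PoincareLipschitzKnitScaleLetters
import Summits.QuantumFields.YangMills.Theorems.PoincareLipschitzSmallRangeOfOneStepSrc
import HarnessLib

/-!
# Crux `HistoryTailL` (stmt-QuantumFields-19936), K2 face v2 `hRegH` (route crux `PoincareLipschitz.BlockLipschitzL`, stmt-QuantumFields-23533) —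
# THE FINAL KNIT `hRegH ⟸ hImprove ∧ [C]`, FILE K-2b «FLAT END-GAME»: the organ `hImprove` (v1, LEAD g9, FROZEN 899858e5) and the displayed [C]-socket
# `hC` («F5 one-step energy improvement with constant slack below the `(1+log r)⁶` threshold», 2e0c4712 — ★w5's F5d-F prints it) turn the flat-shadow
# package of K-1 (unit field, twist defect `τ₀` with `τ₀R ≤ c₁`, twisted one-site optimality, local minimality in every sub-box, bounded energy `Λ₀R`)
# into THE BOND BOUND `‖τ μ z (u(z+e_μ)) − u z‖² ≤ Λ·(R⁻¹ + τ₀)` — read at UNIT radius from the Morrey envelope of ✓`norm_sub_le_of_oneStep_src` (RULING g9-2)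

Cell `ym3-torus` (YM ladder rung R3 = continuum SU(2) Yang–Mills on T³ — a RUNG, NOT the Clay problem: not d = 4, not infinite volume, not a mass gap);
LEAD seat `ym-ust-19936-w1` g9 (bus 2026-08-29T06:49:23Z K-2 architecture; RULINGS g9-1∕2∕3∕5).  Helper `--supports stmt-QuantumFields-19936`; THEOREMS ONLY
(0 `def`, 0 `sorry`); the two displayed hypotheses are written out as binders (no `Prop` letters).  COMPOSITION of landed files: K-2a
✓`PoincareLipschitzKnitFlatEndgameLetters` (constant slack, twisted-vs-flat), ★w2 g12 ✓`PoincareLipschitzKnitDoorRows.doorRows_log6` (source rows (i)(ii)),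
px8 g5 ✓`PoincareLipschitzKnitLadderLetters` (ladder top, boxes, `(1+log 2r)⁶ ≤ 64log⁶r`, `#Q_ρ`), ★w7 g12 ✓`PoincareLipschitzKnitScaleLetters` (`R ≤ r²` under the
scale loss, `log R ≤ 2log r`), px8 g5 ✓`PoincareLipschitzSmallRangeOfOneStepSrc.norm_sub_le_of_oneStep_src` (THE DOOR, at `ρ₀ := 1`).  Nothing here proves
`hImprove`, `hC`, `hRegH`, `BlockLipschitzL`, `HistoryTailL` or a summit statement.

THE ARITHMETIC (g9-2∕g9-3 of record; `d = 3`).  Constants in order: `A` from `hC`; `m := ⌈32A⌉₊ + 2`; `ε := ¼(m²)⁻¹`; `ε₁(ε)` from `hC`; `cT(m, ε₁)` from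
`doorRows_log6`; `κ := max 1 (128∕cT + 288000m∕ε₁)`; `ε₀ := ε₁∕(256m)`; `C₀, R₀` from `hImprove(Λ₀, ε₀, κ)`; `R₂(C₀)` from `exists_threshold_sq_of_scaleLoss`;
`c₁ := C₀⁻¹`, `R₁ := max R₀ R₂ 64 m²`, `Λ := 2·(17√(16·3·8³))²·3·(m³ε₁C₀ + 648m⁴(√ε₁+2)) + 2`.  Then at `(z, R)`: the organ gives the good scale
`r ∈ [R∕(C₀log⁶R), R∕(κlog⁶R)]` with `E_τ(Q_{2r}(z))·log⁶r ≤ ε₀r`; `R ≤ r²` so `r ≥ 8`, `r ≥ m`, `log R ≤ 2log r`; THE WINDOW gives `r ≤ R` and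
`τ₀·r·log⁶r ≤ κ⁻¹` (with `τ₀R ≤ 1`), hence (§1 `regime_of_window`) the row regime `τ₀m^K(1+log m^K)⁶ ≤ cT` for the ladder top `m^K ∈ ((2r−1)∕m, 2r−1]`, and
(§1 `top_below_threshold`) `E(Q_{2r}(z)) ≤ 2E_τ + 2250τ₀²r³ ≤ ε₁r∕(64m·log⁶r) ≤ T(m^K)`; §2 `oneStep_socket` feeds the door's `hone` from `hC` and the constant slack;
the door at `ρ₀ = 1` and §1 `bracket_le` give `‖u(z+e_μ) − u z‖² ≤ CD·3(m³ε₁C₀∕R + 648m⁴(√ε₁+2)τ₀)`; the twisted bond is the flat one `+ τ₀` (§1 `bond_sq_final`).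

WHAT IS PROVED (ns `…Theorems.PoincareLipschitzKnitFlatEndgame`).
* (the pure-real rows `regime_of_window`, `top_below_threshold`, `bracket_le`, `bond_sq_final` are FILE K-2r ✓`…KnitFlatEndgameRows`.)
* §2 ★ `oneStep_socket` — the door's `hone` at every centre of `Q_1(z)` from `hC`'s inner statement and the package (✓`flat_almostMin_const_slack`).
* §3 ★★★ `bond_sq_le_of_hImprove_of_oneStep (hI : ⟨hImprove v1 VERBATIM⟩) (hC : ⟨hC VERBATIM⟩) (Λ₀) (hΛ₀ : 0 < Λ₀) : ∃ Λ R₁ c₁, 0 < Λ ∧ 1 ≤ R₁ ∧ 0 < c₁ ∧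
  ∀ u τ z R τ₀, R₁ ≤ R → 0 ≤ τ₀ → (unit) → (defect τ₀ on Q_{R+1}(z)) → τ₀R ≤ c₁ → (twisted hopt on Q_R(z)) → (local minimality in every sub-box) →
  E_τ(Q_R(z)) ≤ Λ₀R → ∀ μ, ‖τ μ z (u(z+e_μ)) − u z‖² ≤ Λ·(R⁻¹ + τ₀)` — the input rows are K-1 §3's output rows token for token.
HONEST SCOPE.  Conditional on the two displayed texts; YM₃ on T³ is rung R3, not Clay; YM gap NOT proved.

References: R. Schoen, K. Uhlenbeck, J. Diff. Geom. 17 (1982) 307–335 [SchoenUhlenbeck1982] (§4: the small-energy regularity scheme); M. Giaquinta, Annals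
of Math. Studies 105 (1983) [Giaquinta1984] (Ch. III Lemma 2.1 p.86, Thm 1.2 p.70: Campanato∕Morrey iteration with a source).
-/

set_option autoImplicit false

noncomputable section

open scoped BigOperators InnerProductSpace
open Finset

namespace Summit.QuantumFields.YangMills.Theorems.PoincareLipschitzKnitFlatEndgame

open Literature.MathematicalPhysics.QuantumFieldTheory.Balaban1983to89
open B4Eq19LatticeOperators (Zd box unitVec mem_box box_mono box_subset_box self_mem_box add_unitVec_mem_box sub_unitVec_mem_box card_box)
open Summit.QuantumFields.YangMills.Theorems.PoincareLipschitzSmallRangeOfOneStepSrc (norm_sub_le_of_oneStep_src)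
open Summit.QuantumFields.YangMills.Theorems.PoincareLipschitzKnitScaleLetters (exists_threshold_sq_of_scaleLoss log_le_two_mul_log_of_le_sq)
open Summit.QuantumFields.YangMills.Theorems.PoincareLipschitzKnitLadderLetters (exists_ladder_top' box_ladderTop_subset box_subset_box_of_mem_box_one
  one_add_log_two_mul_pow_six_le card_box_three)
open Summit.QuantumFields.YangMills.Theorems.PoincareLipschitzKnitDoorRows (doorRows_log6)

/-! ## §2 The one-step socket of the door, from `hC` and the constant slack -/

set_option maxHeartbeats 400000 in
/-- ★ **THE DOOR'S `hone` AT EVERY CENTRE OF `Q_1(z)`** from the displayed [C]-socket (its inner statement at fixed `A, ε, ε₁`) and the flat-shadow package: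
the twisted local minimality in every sub-box of `Q_R(z)` ⟹ (✓`flat_almostMin_const_slack`) the minimality-with-constant-slack clause on `Q_{r′}(x)`,
`x ∈ Q_1(z)`, `r′ ≤ m^K ≤ 2r − 1`, below the threshold `T r′ = ε₁r′∕(1+log r′)⁶` ⟹ the one-step improvement with slack
`s r′ = 2(4τ₀√(3(2r′+1)³T r′) + 6τ₀²(2r′+1)³)`. [cite: SchoenUhlenbeck1982, §4] -/
theorem oneStep_socket {A ε ε₁ τ₀ : ℝ} {m K : ℕ} {r R : ℤ}
    (hone : ∀ (u : Zd 3 → EuclideanSpace ℝ (Fin 4)) (x : Zd 3) (r : ℤ) (sl : ℝ), 0 ≤ sl → (∀ y, ‖u y‖ = 1) →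
      (∀ w : Zd 3 → EuclideanSpace ℝ (Fin 4), (∀ y, ‖w y‖ = 1) → (∀ y, y ∉ box x (r - 1) → w y = u y) →
        ∑ y ∈ box x r, ∑ μ : Fin 3, ‖u (y + unitVec μ) - u y‖ ^ 2 ≤ (∑ y ∈ box x r, ∑ μ : Fin 3, ‖w (y + unitVec μ) - w y‖ ^ 2) + sl) →
      (∑ y ∈ box x r, ∑ μ : Fin 3, ‖u (y + unitVec μ) - u y‖ ^ 2) * (1 + Real.log r) ^ 6 ≤ ε₁ * r →
      ∀ ρ : ℤ, 1 ≤ ρ → ρ + 1 ≤ r →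
        ∑ y ∈ box x ρ, ∑ μ : Fin 3, ‖u (y + unitVec μ) - u y‖ ^ 2 ≤
          (A * (((ρ : ℝ) + 1) / r) ^ 3 + ε) * (∑ y ∈ box x r, ∑ μ : Fin 3, ‖u (y + unitVec μ) - u y‖ ^ 2) + 2 * sl)
    (u : Zd 3 → EuclideanSpace ℝ (Fin 4)) (τ : Fin 3 → Zd 3 → (EuclideanSpace ℝ (Fin 4) ≃ₗᵢ[ℝ] EuclideanSpace ℝ (Fin 4))) (z : Zd 3)
    (hτ0 : 0 ≤ τ₀) (hu : ∀ y, ‖u y‖ = 1)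
    (hdef : ∀ y ∈ box z (R + 1), ∀ (μ : Fin 3) (w : EuclideanSpace ℝ (Fin 4)), ‖τ μ y w - w‖ ≤ τ₀ * ‖w‖)
    (hloc : ∀ (z' : Zd 3) (R' : ℤ), 0 ≤ R' → box z' (R' + 1) ⊆ box z R →
      ∀ v : Zd 3 → EuclideanSpace ℝ (Fin 4), (∀ y, y ∉ box z' R' → v y = u y) → (∀ y ∈ box z' R', ‖v y‖ = 1) →
        ∑ y ∈ box z' (R' + 1), ∑ μ : Fin 3, ‖τ μ y (u (y + unitVec μ)) - u y‖ ^ 2 ≤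
          ∑ y ∈ box z' (R' + 1), ∑ μ : Fin 3, ‖τ μ y (v (y + unitVec μ)) - v y‖ ^ 2)
    (hsub : box z (2 * r) ⊆ box z R) (hKle : (m : ℤ) ^ K ≤ 2 * r - 1) :
    ∀ x ∈ box z (((1 : ℕ) : ℤ)), ∀ ρ r' : ℤ, 1 ≤ ρ → ρ + 1 ≤ r' → r' ≤ (m : ℤ) ^ K →
      ∑ y ∈ box x r', ∑ μ : Fin 3, ‖u (y + unitVec μ) - u y‖ ^ 2 ≤ ε₁ * r' / (1 + Real.log r') ^ 6 →
      ∑ y ∈ box x ρ, ∑ μ : Fin 3, ‖u (y + unitVec μ) - u y‖ ^ 2 ≤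
        (A * (((ρ : ℝ) + 1) / r') ^ 3 + ε) * (∑ y ∈ box x r', ∑ μ : Fin 3, ‖u (y + unitVec μ) - u y‖ ^ 2) +
          2 * (4 * τ₀ * Real.sqrt (3 * (2 * (r' : ℝ) + 1) ^ 3 * (ε₁ * r' / (1 + Real.log r') ^ 6)) +
            2 * τ₀ ^ 2 * (3 * (2 * (r' : ℝ) + 1) ^ 3)) := by
  intro x hx ρ r' hρ hρr' hr'M hEr'
  have hx1 : x ∈ box z 1 := by simpa using hx
  have hr'2 : (2 : ℤ) ≤ r' := by linarith
  have hr'R : (1 : ℝ) ≤ r' := by exact_mod_cast (show (1 : ℤ) ≤ r' by linarith)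
  have hsubx2r : box x r' ⊆ box z (2 * r) := box_subset_box_of_mem_box_one hx1 (by linarith [hKle])
  have hsubxR : box x (r' - 1 + 1) ⊆ box z R := by rw [sub_add_cancel]; exact hsubx2r.trans hsub
  have hdefx : ∀ y ∈ box x (r' - 1 + 1), ∀ (μ : Fin 3) (w : EuclideanSpace ℝ (Fin 4)), ‖τ μ y w - w‖ ≤ τ₀ * ‖w‖ :=
    fun y hy μ w => hdef y ((hsubxR.trans (box_mono z (by linarith))) hy) μ w
  have hlocx := hloc x (r' - 1) (by linarith) hsubxR
  have hEr'' : ∑ y ∈ box x (r' - 1 + 1), ∑ μ, ‖u (y + unitVec μ) - u y‖ ^ 2 ≤ ε₁ * r' / (1 + Real.log r') ^ 6 := by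
    rw [sub_add_cancel]; exact hEr'
  have halmost := flat_almostMin_const_slack τ hτ0 x (r' - 1) hdefx u hu hlocx hEr''
  rw [sub_add_cancel] at halmost
  have hL0 : 0 < (1 + Real.log (r' : ℝ)) ^ 6 := by have := Real.log_nonneg hr'R; positivity
  have hthrC : (∑ y ∈ box x r', ∑ μ : Fin 3, ‖u (y + unitVec μ) - u y‖ ^ 2) * (1 + Real.log (r' : ℝ)) ^ 6 ≤ ε₁ * r' := by
    rw [le_div_iff₀ hL0] at hEr'; exact hEr'
  have hslk0 : 0 ≤ 4 * τ₀ * Real.sqrt ((((3 : ℕ) : ℝ) * ((box x r').card : ℝ)) * (ε₁ * r' / (1 + Real.log r') ^ 6)) +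
      2 * (τ₀ ^ 2 * (((3 : ℕ) : ℝ) * ((box x r').card : ℝ))) :=
    add_nonneg (mul_nonneg (mul_nonneg (by norm_num) hτ0) (Real.sqrt_nonneg _))
      (mul_nonneg (by norm_num) (mul_nonneg (sq_nonneg _) (mul_nonneg (Nat.cast_nonneg _) (Nat.cast_nonneg _))))
  have hstep := hone u x r' _ hslk0 hu halmost hthrC ρ hρ hρr'
  have hcard : ((box x r').card : ℝ) = (2 * (r' : ℝ) + 1) ^ 3 := card_box_three x (le_trans (by norm_num) hr'2)
  have hslk_eq : 2 * (4 * τ₀ * Real.sqrt ((((3 : ℕ) : ℝ) * ((box x r').card : ℝ)) * (ε₁ * r' / (1 + Real.log r') ^ 6)) +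
      2 * (τ₀ ^ 2 * (((3 : ℕ) : ℝ) * ((box x r').card : ℝ)))) =
      2 * (4 * τ₀ * Real.sqrt (3 * (2 * (r' : ℝ) + 1) ^ 3 * (ε₁ * r' / (1 + Real.log r') ^ 6)) + 2 * τ₀ ^ 2 * (3 * (2 * (r' : ℝ) + 1) ^ 3)) := by
    rw [hcard]; push_cast; ring
  rw [← hslk_eq]
  exact hstep

/-! ## §3 ★★★ The flat end-game -/

set_option maxHeartbeats 800000 in
/-- ★★★ **THE FLAT END-GAME.**  `hImprove` (v1 899858e5, VERBATIM) and the [C]-socket `hC` (2e0c4712, VERBATIM) imply: for every energy bound `Λ₀` there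
are `Λ, R₁, c₁` such that every unit lattice map `u : ℤ³ → S³ ⊂ ℝ⁴` with bond twists of defect `τ₀` on `Q_{R+1}(z)` (`R ≥ R₁`, `τ₀R ≤ c₁`), twisted one-site
optimal on `Q_R(z)`, locally minimising the twisted energy in every sub-box of `Q_R(z)`, with `E_τ(Q_R(z)) ≤ Λ₀R`, has CENTRE BONDS
`‖τ μ z (u(z+e_μ)) − u z‖² ≤ Λ·(R⁻¹ + τ₀)`.  (The hypothesis rows are the output rows of ✓`PoincareLipschitzKnitFlatPackage.flatPackage_at_prefix`.)
[cite: SchoenUhlenbeck1982, §4; Giaquinta1984, Ch. III Lemma 2.1 p.86] -/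
theorem bond_sq_le_of_hImprove_of_oneStep
    (hI : ∀ (Λ₀ ε₀ κ : ℝ), 0 < Λ₀ → 0 < ε₀ → 1 ≤ κ →
      ∃ (C₀ R₀ : ℝ), 1 ≤ C₀ ∧ 1 ≤ R₀ ∧
      ∀ (u : Zd 3 → EuclideanSpace ℝ (Fin 4)) (τ : Fin 3 → Zd 3 → (EuclideanSpace ℝ (Fin 4) ≃ₗᵢ[ℝ] EuclideanSpace ℝ (Fin 4)))
      (z : Zd 3) (R : ℤ) (τ₀ : ℝ),
      R₀ ≤ R →
      (∀ y, ‖u y‖ = 1) →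
      (∀ y ∈ box z (R + 1), ∀ (μ : Fin 3) (w : EuclideanSpace ℝ (Fin 4)), ‖τ μ y w - w‖ ≤ τ₀ * ‖w‖) →
      τ₀ * (R : ℝ) ≤ C₀⁻¹ →
      (∀ y ∈ box z R,
      ‖∑ μ : Fin 3, (τ μ y (u (y + unitVec μ)) + (τ μ (y - unitVec μ)).symm (u (y - unitVec μ)))‖ • u y =
      ∑ μ : Fin 3, (τ μ y (u (y + unitVec μ)) + (τ μ (y - unitVec μ)).symm (u (y - unitVec μ)))) →
      (∀ (z' : Zd 3) (R' : ℤ), 0 ≤ R' → box z' (R' + 1) ⊆ box z R →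
      ∀ v : Zd 3 → EuclideanSpace ℝ (Fin 4), (∀ y, y ∉ box z' R' → v y = u y) → (∀ y ∈ box z' R', ‖v y‖ = 1) →
      ∑ y ∈ box z' (R' + 1), ∑ μ : Fin 3, ‖τ μ y (u (y + unitVec μ)) - u y‖ ^ 2 ≤
      ∑ y ∈ box z' (R' + 1), ∑ μ : Fin 3, ‖τ μ y (v (y + unitVec μ)) - v y‖ ^ 2) →
      (∑ y ∈ box z R, ∑ μ : Fin 3, ‖τ μ y (u (y + unitVec μ)) - u y‖ ^ 2 ≤ Λ₀ * R) →
      ∃ r : ℤ, 1 ≤ r ∧ (R : ℝ) ≤ C₀ * Real.log R ^ 6 * r ∧ κ * Real.log R ^ 6 * r ≤ R ∧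
      box z (2 * r) ⊆ box z R ∧
      (∑ y ∈ box z (2 * r), ∑ μ : Fin 3, ‖τ μ y (u (y + unitVec μ)) - u y‖ ^ 2) * Real.log r ^ 6 ≤ ε₀ * r)
    (hC : ∃ A : ℝ, 0 ≤ A ∧ ∀ ε : ℝ, 0 < ε → ∃ ε₁ : ℝ, 0 < ε₁ ∧
      ∀ (u : Zd 3 → EuclideanSpace ℝ (Fin 4)) (x : Zd 3) (r : ℤ) (sl : ℝ), 0 ≤ sl →
      (∀ y, ‖u y‖ = 1) →
      (∀ w : Zd 3 → EuclideanSpace ℝ (Fin 4), (∀ y, ‖w y‖ = 1) → (∀ y, y ∉ box x (r - 1) → w y = u y) →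
      ∑ y ∈ box x r, ∑ μ : Fin 3, ‖u (y + unitVec μ) - u y‖ ^ 2 ≤
      (∑ y ∈ box x r, ∑ μ : Fin 3, ‖w (y + unitVec μ) - w y‖ ^ 2) + sl) →
      (∑ y ∈ box x r, ∑ μ : Fin 3, ‖u (y + unitVec μ) - u y‖ ^ 2) * (1 + Real.log r) ^ 6 ≤ ε₁ * r →
      ∀ ρ : ℤ, 1 ≤ ρ → ρ + 1 ≤ r →
      ∑ y ∈ box x ρ, ∑ μ : Fin 3, ‖u (y + unitVec μ) - u y‖ ^ 2 ≤
      (A * (((ρ : ℝ) + 1) / r) ^ 3 + ε) * (∑ y ∈ box x r, ∑ μ : Fin 3, ‖u (y + unitVec μ) - u y‖ ^ 2) + 2 * sl)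
    (Λ₀ : ℝ) (hΛ₀ : 0 < Λ₀) :
    ∃ (Λ R₁ c₁ : ℝ), 0 < Λ ∧ 1 ≤ R₁ ∧ 0 < c₁ ∧
      ∀ (u : Zd 3 → EuclideanSpace ℝ (Fin 4)) (τ : Fin 3 → Zd 3 → (EuclideanSpace ℝ (Fin 4) ≃ₗᵢ[ℝ] EuclideanSpace ℝ (Fin 4)))
        (z : Zd 3) (R : ℤ) (τ₀ : ℝ),
        R₁ ≤ R → 0 ≤ τ₀ →
        (∀ y, ‖u y‖ = 1) →
        (∀ y ∈ box z (R + 1), ∀ (μ : Fin 3) (w : EuclideanSpace ℝ (Fin 4)), ‖τ μ y w - w‖ ≤ τ₀ * ‖w‖) →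
        τ₀ * (R : ℝ) ≤ c₁ →
        (∀ y ∈ box z R,
          ‖∑ μ : Fin 3, (τ μ y (u (y + unitVec μ)) + (τ μ (y - unitVec μ)).symm (u (y - unitVec μ)))‖ • u y =
            ∑ μ : Fin 3, (τ μ y (u (y + unitVec μ)) + (τ μ (y - unitVec μ)).symm (u (y - unitVec μ)))) →
        (∀ (z' : Zd 3) (R' : ℤ), 0 ≤ R' → box z' (R' + 1) ⊆ box z R →
          ∀ v : Zd 3 → EuclideanSpace ℝ (Fin 4), (∀ y, y ∉ box z' R' → v y = u y) → (∀ y ∈ box z' R', ‖v y‖ = 1) →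
            ∑ y ∈ box z' (R' + 1), ∑ μ : Fin 3, ‖τ μ y (u (y + unitVec μ)) - u y‖ ^ 2 ≤
              ∑ y ∈ box z' (R' + 1), ∑ μ : Fin 3, ‖τ μ y (v (y + unitVec μ)) - v y‖ ^ 2) →
        (∑ y ∈ box z R, ∑ μ : Fin 3, ‖τ μ y (u (y + unitVec μ)) - u y‖ ^ 2 ≤ Λ₀ * R) →
        ∀ μ : Fin 3, ‖τ μ z (u (z + unitVec μ)) - u z‖ ^ 2 ≤ Λ * (((R : ℝ))⁻¹ + τ₀) := by
  classical
  obtain ⟨A, hA0, hCA⟩ := hC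
  -- (0) the constants, in order
  obtain ⟨m, hm_def⟩ : ∃ m : ℕ, m = ⌈32 * A⌉₊ + 2 := ⟨_, rfl⟩
  have hm2 : 2 ≤ m := by rw [hm_def]; omega
  have hmA' : 32 * A ≤ (m : ℝ) := by
    have h1 : 32 * A ≤ (⌈32 * A⌉₊ : ℝ) := Nat.le_ceil _
    have h2 : ((⌈32 * A⌉₊ : ℕ) : ℝ) ≤ (m : ℝ) := by rw [hm_def]; push_cast; linarith
    linarith
  have hm2R : (2 : ℝ) ≤ m := by exact_mod_cast hm2
  have hm0 : (0 : ℝ) < m := by linarith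
  obtain ⟨ε, hε_def⟩ : ∃ ε : ℝ, ε = 1 / 4 * ((m : ℝ) ^ (3 - 1))⁻¹ := ⟨_, rfl⟩
  have hεpos : 0 < ε := by rw [hε_def]; positivity
  obtain ⟨ε₁, hε₁, hone⟩ := hCA ε hεpos
  obtain ⟨cT, hcT, hrows⟩ := doorRows_log6 hm2 hε₁
  obtain ⟨κ, hκ_def⟩ : ∃ κ : ℝ, κ = max 1 (128 / cT + 288000 * m / ε₁) := ⟨_, rfl⟩
  have hκ1 : 1 ≤ κ := by rw [hκ_def]; exact le_max_left _ _
  have hκ0 : 0 < κ := by linarith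
  have hκ2 : 128 / cT + 288000 * m / ε₁ ≤ κ := by rw [hκ_def]; exact le_max_right _ _
  have hκa : 128 / cT ≤ κ := by
    have : 0 ≤ 288000 * (m : ℝ) / ε₁ := by positivity
    linarith
  have hκb : 288000 * m / ε₁ ≤ κ := by
    have : 0 ≤ 128 / cT := by positivity
    linarith
  obtain ⟨ε₀, hε₀_def⟩ : ∃ ε₀ : ℝ, ε₀ = ε₁ / (256 * m) := ⟨_, rfl⟩
  have hε₀ : 0 < ε₀ := by rw [hε₀_def]; positivity
  obtain ⟨C₀, R₀, hC₀, hR₀, hI'⟩ := hI Λ₀ ε₀ κ hΛ₀ hε₀ hκ1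
  obtain ⟨R₂, hR₂, hsqR⟩ := exists_threshold_sq_of_scaleLoss C₀
  obtain ⟨CD, hCD_def⟩ : ∃ CD : ℝ, CD = (17 * Real.sqrt (16 * 3 * 8 ^ 3)) ^ 2 := ⟨_, rfl⟩
  have hCD0 : 0 ≤ CD := by rw [hCD_def]; positivity
  obtain ⟨P, hP_def⟩ : ∃ P : ℝ, P = (m : ℝ) ^ 3 * ε₁ * C₀ := ⟨_, rfl⟩
  obtain ⟨Q, hQ_def⟩ : ∃ Q : ℝ, Q = 648 * (m : ℝ) ^ 4 * (Real.sqrt ε₁ + 2) := ⟨_, rfl⟩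
  have hP0 : 0 ≤ P := by rw [hP_def]; positivity
  have hQ0 : 0 ≤ Q := by rw [hQ_def]; positivity
  refine ⟨2 * CD * 3 * (P + Q) + 2, max R₀ (max R₂ (max 64 ((m : ℝ) ^ 2))), C₀⁻¹, by positivity,
    le_trans hR₀ (le_max_left _ _), by positivity, ?_⟩
  intro u τ z R τ₀ hR hτ0 hu hdef hτR hopt hloc hE μ
  -- (1) the size of `R`
  have hRR₀ : R₀ ≤ (R : ℝ) := le_trans (le_max_left _ _) hR
  have hRR₂ : R₂ ≤ (R : ℝ) := le_trans ((le_max_left _ _).trans (le_max_right _ _)) hR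
  have hR64 : (64 : ℝ) ≤ R := le_trans (((le_max_left _ _).trans (le_max_right _ _)).trans (le_max_right _ _)) hR
  have hRm2 : (m : ℝ) ^ 2 ≤ R := le_trans (((le_max_right _ _).trans (le_max_right _ _)).trans (le_max_right _ _)) hR
  have hRpos : (0 : ℝ) < R := by linarith
  have hC₀1 : C₀⁻¹ ≤ 1 := inv_le_one_of_one_le₀ hC₀
  have hτR1 : τ₀ * (R : ℝ) ≤ 1 := hτR.trans hC₀1
  have hτ01 : τ₀ ≤ 1 := by nlinarith
  -- (2) the organ at `(z, R)`
  obtain ⟨r, hr1, hloss, hwin, hsub, hsmall⟩ := hI' u τ z R τ₀ hRR₀ hu hdef hτR hopt hloc hE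
  have hr1R : (1 : ℝ) ≤ r := by exact_mod_cast hr1
  have hr0 : (0 : ℝ) < r := by linarith
  have hRr2 : (R : ℝ) ≤ (r : ℝ) ^ 2 := hsqR R r hRR₂ hr0 hloss
  have hr8 : (8 : ℝ) ≤ r := by nlinarith
  have hrm : (m : ℝ) ≤ r := by nlinarith
  have hlogR1 : 1 ≤ Real.log (R : ℝ) := by
    rw [Real.le_log_iff_exp_le hRpos]; have := Real.exp_one_lt_d9; linarith
  have hlogr0 : 0 < Real.log (r : ℝ) := Real.log_pos (by linarith)
  have hlog6R : Real.log (R : ℝ) ^ 6 ≤ 64 * Real.log (r : ℝ) ^ 6 := by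
    calc Real.log (R : ℝ) ^ 6 ≤ (2 * Real.log r) ^ 6 := pow_le_pow_left₀ (by linarith) (log_le_two_mul_log_of_le_sq hRpos hRr2) 6
      _ = 64 * Real.log (r : ℝ) ^ 6 := by ring
  -- the window: `r·log⁶R ≤ R∕κ`, hence `r ≤ R` and `τ₀ r log⁶ r ≤ κ⁻¹`
  have hwin' : (r : ℝ) * Real.log (R : ℝ) ^ 6 ≤ R / κ := by rw [le_div_iff₀ hκ0]; linarith
  have hrR : (r : ℝ) ≤ R := by
    have h1 : (r : ℝ) ≤ r * Real.log (R : ℝ) ^ 6 := le_mul_of_one_le_right hr0.le (one_le_pow₀ hlogR1)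
    have h2 : (R : ℝ) / κ ≤ R := div_le_self hRpos.le hκ1
    linarith
  have hτr1 : τ₀ * (r : ℝ) ≤ 1 := by nlinarith
  have hkey : τ₀ * r * Real.log (r : ℝ) ^ 6 ≤ κ⁻¹ := by
    have h1 : Real.log (r : ℝ) ^ 6 ≤ Real.log (R : ℝ) ^ 6 := pow_le_pow_left₀ hlogr0.le (Real.log_le_log hr0 hrR) 6
    calc τ₀ * r * Real.log (r : ℝ) ^ 6 ≤ τ₀ * r * Real.log (R : ℝ) ^ 6 := mul_le_mul_of_nonneg_left h1 (by positivity)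
      _ = τ₀ * (r * Real.log (R : ℝ) ^ 6) := by ring
      _ ≤ τ₀ * (R / κ) := mul_le_mul_of_nonneg_left hwin' hτ0
      _ = (τ₀ * R) * κ⁻¹ := by rw [div_eq_mul_inv]; ring
      _ ≤ 1 * κ⁻¹ := mul_le_mul_of_nonneg_right hτR1 (by positivity)
      _ = κ⁻¹ := one_mul _
  have hkey2 : τ₀ ^ 2 * r ^ 2 * Real.log (r : ℝ) ^ 6 ≤ κ⁻¹ := by
    calc τ₀ ^ 2 * r ^ 2 * Real.log (r : ℝ) ^ 6 = (τ₀ * r) * (τ₀ * r * Real.log (r : ℝ) ^ 6) := by ring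
      _ ≤ 1 * (τ₀ * r * Real.log (r : ℝ) ^ 6) := mul_le_mul_of_nonneg_right hτr1 (by positivity)
      _ ≤ κ⁻¹ := by rw [one_mul]; exact hkey
  -- (3) the ladder `m^K ∈ ((2r−1)∕m, 2r−1]`
  have hmr_int : (m : ℤ) ≤ 2 * r - 1 := by
    have : (m : ℝ) ≤ 2 * (r : ℝ) - 1 := by linarith
    exact_mod_cast this
  obtain ⟨K, _, hKlt, hKle, hM2⟩ := exists_ladder_top' hm2 hmr_int
  have hMR : ((m : ℝ)) ^ K ≤ 2 * r - 1 := by exact_mod_cast hKle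
  have hM2r : ((m : ℝ)) ^ K ≤ 2 * r := by linarith
  have hM1 : (1 : ℝ) ≤ (m : ℝ) ^ K := by
    have : (2 : ℝ) ≤ (m : ℝ) ^ K := by exact_mod_cast hM2
    linarith
  have hrM : (r : ℝ) / m ≤ (m : ℝ) ^ K := by
    have h1 : (r : ℝ) / m ≤ ((2 * r - 1 : ℤ) : ℝ) / m := by refine div_le_div_of_nonneg_right ?_ hm0.le; push_cast; linarith
    linarith
  -- (4) the rows in their regime
  have hreg := regime_of_window hτ0 hr8 hM1 hM2r hkey hκ0 hcT hκa
  obtain ⟨E, hE_def⟩ : ∃ E : Zd 3 → ℤ → ℝ, E = fun x ρ => ∑ y ∈ box x ρ, ∑ μ, ‖u (y + unitVec μ) - u y‖ ^ 2 := ⟨_, rfl⟩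
  obtain ⟨T, hT_def⟩ : ∃ T : ℤ → ℝ, T = fun ρ : ℤ => ε₁ * (ρ : ℝ) / (1 + Real.log (ρ : ℝ)) ^ 6 := ⟨_, rfl⟩
  obtain ⟨s, hs_def⟩ : ∃ s : ℤ → ℝ, s = fun ρ : ℤ => 2 * (4 * τ₀ * Real.sqrt (3 * (2 * (ρ : ℝ) + 1) ^ 3 * T ρ) + 2 * τ₀ ^ 2 * (3 * (2 * (ρ : ℝ) + 1) ^ 3)) :=
    ⟨_, rfl⟩
  have hEap : ∀ x ρ, E x ρ = ∑ y ∈ box x ρ, ∑ μ, ‖u (y + unitVec μ) - u y‖ ^ 2 := fun x ρ => by rw [hE_def]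
  have hTap : ∀ ρ : ℤ, T ρ = ε₁ * ρ / (1 + Real.log ρ) ^ 6 := fun ρ => by rw [hT_def]
  have hsap : ∀ ρ : ℤ, s ρ = 2 * (4 * τ₀ * Real.sqrt (3 * (2 * (ρ : ℝ) + 1) ^ 3 * T ρ) + 2 * τ₀ ^ 2 * (3 * (2 * (ρ : ℝ) + 1) ^ 3)) :=
    fun ρ => by rw [hs_def]
  obtain ⟨hT, hS⟩ := hrows τ₀ K T s hτ0 (fun ρ _ => hTap ρ) (fun ρ _ => (hsap ρ).le) hreg
  have hE0 : ∀ x ρ, 0 ≤ E x ρ := fun x ρ => by rw [hEap]; exact Finset.sum_nonneg fun _ _ => Finset.sum_nonneg fun _ _ => sq_nonneg _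
  have hEmono : ∀ x x' (ρ ρ' : ℤ), box x ρ ⊆ box x' ρ' → E x ρ ≤ E x' ρ' := fun x x' ρ ρ' h => by
    rw [hEap, hEap]; exact Finset.sum_le_sum_of_subset_of_nonneg h fun _ _ _ => Finset.sum_nonneg fun _ _ => sq_nonneg _
  -- (5) the socket
  have honeD : ∀ x ∈ box z (((1 : ℕ) : ℤ)), ∀ ρ r' : ℤ, 1 ≤ ρ → ρ + 1 ≤ r' → r' ≤ (m : ℤ) ^ K → E x r' ≤ T r' →
      E x ρ ≤ (A * (((ρ : ℝ) + 1) / r') ^ 3 + ε) * E x r' + s r' := by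
    intro x hx ρ r' hρ hρr' hr'M hEr'
    rw [hEap, hTap] at hEr'
    rw [hEap, hEap, hsap, hTap]
    exact oneStep_socket hone u τ z hτ0 hu hdef hloc hsub hKle x hx ρ r' hρ hρr' hr'M hEr'
  -- (6) the top of the ladder
  have htop : ∀ x ∈ box z (((1 : ℕ) : ℤ)), E x ((m : ℤ) ^ K) ≤ E z (2 * r) := by
    intro x hx
    have hx1 : x ∈ box z 1 := by simpa using hx
    exact hEmono x z _ _ (box_ladderTop_subset hx1 hKle)
  have hEτ : ∑ y ∈ box z (2 * r), ∑ μ : Fin 3, ‖τ μ y (u (y + unitVec μ)) - u y‖ ^ 2 ≤ ε₀ * r / Real.log (r : ℝ) ^ 6 := by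
    rw [le_div_iff₀ (by positivity)]; exact hsmall
  have hsubR1 : box z (2 * r) ⊆ box z (R + 1) := hsub.trans (box_mono z (by linarith))
  have hflat := energy_le_two_mul_twist τ hτ0 (box z (2 * r)) (fun y hy μ w => hdef y (hsubR1 hy) μ w) u (fun y _ μ => hu _)
  rw [← hEap] at hflat
  have hcard2r' : ((box z (2 * r)).card : ℝ) ≤ 125 * (r : ℝ) ^ 3 := by
    rw [card_box_three z (by linarith)]; push_cast
    calc (2 * (2 * (r : ℝ)) + 1) ^ 3 ≤ (5 * (r : ℝ)) ^ 3 := pow_le_pow_left₀ (by positivity) (by linarith) 3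
      _ = 125 * (r : ℝ) ^ 3 := by ring
  have hEtop_le : E z (2 * r) ≤ 2 * (∑ y ∈ box z (2 * r), ∑ μ : Fin 3, ‖τ μ y (u (y + unitVec μ)) - u y‖ ^ 2) +
      2250 * τ₀ ^ 2 * (r : ℝ) ^ 3 := by
    have h3 : (6 : ℝ) * (τ₀ ^ 2 * (((3 : ℕ) : ℝ) * ((box z (2 * r)).card : ℝ))) ≤ 2250 * τ₀ ^ 2 * (r : ℝ) ^ 3 := by
      have := mul_le_mul_of_nonneg_left hcard2r' (show 0 ≤ 18 * τ₀ ^ 2 by positivity)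
      calc (6 : ℝ) * (τ₀ ^ 2 * (((3 : ℕ) : ℝ) * ((box z (2 * r)).card : ℝ))) = 18 * τ₀ ^ 2 * ((box z (2 * r)).card : ℝ) := by push_cast; ring
        _ ≤ 18 * τ₀ ^ 2 * (125 * (r : ℝ) ^ 3) := this
        _ = 2250 * τ₀ ^ 2 * (r : ℝ) ^ 3 := by ring
    linarith
  obtain ⟨hEtop64, hTM⟩ := top_below_threshold hε₁ hm2R hr8 hε₀_def hEτ hEtop_le hkey2 hκ0 hκb hrM hM2r hM1
  have hthr : ∀ x ∈ box z (((1 : ℕ) : ℤ)), E x ((m : ℤ) ^ K) ≤ T ((m : ℤ) ^ K) := by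
    intro x hx
    refine (htop x hx).trans (hEtop64.trans ?_)
    rw [hTap]; push_cast; exact hTM
  -- (7) the door at `ρ₀ = 1`
  obtain ⟨Ns, hNs_def⟩ : ∃ Ns : ℝ, Ns = 324 * (τ₀ * Real.sqrt ε₁ + τ₀ ^ 2 * (m : ℝ) ^ K) := ⟨_, rfl⟩
  have hNs0 : 0 ≤ Ns := by rw [hNs_def]; positivity
  have hmA : (2 : ℝ) ^ (3 + 2) * A ≤ m := by norm_num; linarith
  have hε : ε ≤ 1 / 4 * ((m : ℝ) ^ (3 - 1))⁻¹ := hε_def.le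
  have hM2' : 2 * (((1 : ℕ) : ℤ)) ≤ (m : ℤ) ^ K := by simpa using hM2
  have hS' : ∀ k, 1 ≤ k → k ≤ K → s ((m : ℤ) ^ k) ≤ Ns * ((m : ℝ) ^ (3 - 1)) ^ k := by
    intro k hk hkK; rw [hNs_def]; exact hS k hk hkK
  have hdoor := norm_sub_le_of_oneStep_src (d := 3) (by norm_num) u E hEap T s hA0 hm2 hmA hε K hNs0 z (ρ₀ := 1)
    le_rfl hM2' hT hS' honeD htop hthr (z + unitVec μ) (by simpa using add_unitVec_mem_box (self_mem_box z le_rfl) μ)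
  -- (8) the read-off
  have hbracket := bracket_le hε₁ hm2R hr8 hτ0 hRpos hC₀ (hE0 z _) hEtop64 hloss hlog6R hrM hM2r hτr1 hNs_def
  have hX0 : 0 ≤ (((m : ℝ)) ^ (3 - 1) * E z (2 * r) / ((m : ℝ) ^ K) ^ (3 - 1) + 2 * ((m : ℝ) ^ (3 - 1)) ^ 2 * Ns) * (2 * (((1 : ℕ) : ℝ)) + 1) := by
    have : 0 ≤ E z (2 * r) := hE0 z _
    positivity
  have hflatbond : ‖u (z + unitVec μ) - u z‖ ^ 2 ≤ CD * (3 * (P / R + Q * τ₀)) := by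
    have h1 := pow_le_pow_left₀ (norm_nonneg _) hdoor 2
    rw [mul_pow, Real.sq_sqrt hX0] at h1
    have e31 : (3 - 1 : ℕ) = 2 := rfl
    rw [e31] at h1
    rw [hCD_def, hP_def, hQ_def]
    refine h1.trans (mul_le_mul_of_nonneg_left ?_ (by positivity))
    push_cast at hbracket ⊢
    exact hbracket
  have hR0int : (0 : ℤ) ≤ R := by exact_mod_cast hRpos.le
  have htwist : ‖τ μ z (u (z + unitVec μ)) - u z‖ ≤ ‖u (z + unitVec μ) - u z‖ + τ₀ :=
    norm_twist_sub_le (τ μ z) (fun w => hdef z (self_mem_box z (by linarith [hR0int])) μ w) (hu _)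
  exact bond_sq_final (norm_nonneg _) hτ0 hτ01 hRpos hCD0 hP0 hQ0 hflatbond htwist (norm_nonneg _)

end Summit.QuantumFields.YangMills.Theorems.PoincareLipschitzKnitFlatEndgame

end
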